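import Mathlib
import Summits.Ventures.PercRepro.TriangleCapCherryPairs

/-!
# PercRepro — the `m = k` diagonal of the cherry table, the bound: every finite simple graph with at most as
many edges as vertices has `Σ_v C(d(v), 2) ≤ C(k − 1, 2) + 2` (p3, gen 30)

The lane's `K₄⁻`-free cherry table (P3-TRIANGLE-CAP.md §10x(f) / §10z(b); the engine's twin INBOX 12184) has the
star rows `m ≤ k − 1` solved exactly (TriangleCapStar / TriangleCapPairwise: the maximum is `C(m, 2)`, attained
exactly there).  The next row is the diagonal `m = k`, where the census reads `(7,7) 17`, `(8,8) 23`, `(9,9) 30`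
`= C(k − 1, 2) + 2`.  This module proves that closed form as an upper bound for EVERY `k`, on EVERY finite
simple graph (the `K₄⁻` hypothesis is not needed for the bound); the companion module TriangleCapStarPlus
exhibits the extremal graph inside the row's class.

* `deg_add_deg_add_deg_le_of_adj` — for an edge `x ~ y` off a vertex `v`: `d(x) + d(y) + d(v) ≤ m + 3` (the
  edges at `x` or `y` number `d(x) + d(y) − 1`, and at most two of the `d(v)` edges at `v` are among them);
* `sum_deg_neighbors_add_le` — the degree budget at the neighbours of `v`: `Σ_{w ∈ N(v)} d(w) + d(v) ≤ 2m`;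
* `two_mul_sum_deg_sq_le` — **the vertex count** at a vertex of degree `d`: splitting the `2m` ordered
  adjacent pairs into the `2d` touching `v` (they contribute `2d² + 2Σ_{N(v)} d(w)`) and the `2(m − d)` off `v`
  (at most `m + 3 − d` each), `2 Σ_x d(x)² + 2(m − d)·d + 2d ≤ 2d² + 4m + 2(m − d)(m + 3)`;
* **`cherries_le_choose_two_add_two`** — `Σ_v C(d(v), 2) ≤ C(k − 1, 2) + 2` whenever `m ≤ k`: at a vertex of
  degree `d ≥ 3` the vertex count gives `2·cherries ≤ d² − d + (m − d)(m + 3 − d)`, which is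
  `≤ (k − 1)(k − 2) + 4` because `2(d − 3)(d − (k − 1)) ≤ 0`; if every degree is `≤ 2`, `cherries ≤ k`;
* `cherries_le_of_card_edges_eq` — the same on `Fin k` with exactly `k` edges.

The bound is the `m = n` case of Ahlswede–Katona 1978 (the quasi-star is extremal); it is NOT claimed new at
statement level — it is the kernel record of the table's diagonal (`(5,5) 8 · (6,6) 12 · (7,7) 17 · (8,8) 23 ·
(9,9) 30`) as one theorem for every `k`.  Axioms: standard.
-/

namespace PercRepro

namespace TriangleCap

namespace C047

open Finset

variable {V : Type*} [Fintype V] [DecidableEq V]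

/-- An edge at `v` containing `x` or `y` (with `x, y ≠ v`) is `s(v, x)` or `s(v, y)`. -/
theorem incidenceFinset_inter_union_subset (D : SimpleGraph V) [DecidableRel D.Adj] {v x y : V}
    (hx : x ≠ v) (hy : y ≠ v) :
    D.incidenceFinset v ∩ (D.incidenceFinset x ∪ D.incidenceFinset y) ⊆ {s(v, x), s(v, y)} := by
  intro e he
  rw [mem_inter, mem_union, SimpleGraph.mem_incidenceFinset, SimpleGraph.mem_incidenceFinset,
    SimpleGraph.mem_incidenceFinset] at he
  rw [mem_insert, mem_singleton]
  obtain ⟨h1, h2⟩ := he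
  rcases h2 with h2 | h2
  · exact Or.inl ((Sym2.mem_and_mem_iff hx.symm).mp ⟨h1.2, h2.2⟩)
  · exact Or.inr ((Sym2.mem_and_mem_iff hy.symm).mp ⟨h1.2, h2.2⟩)

/-- **An edge off `v` is disjoint from at least `d(v) − 2` of the edges at `v`:** for `x ~ y` with `x, y ≠ v`,
`d(x) + d(y) + d(v) ≤ m + 3` (the edges at `x` or `y` number `d(x) + d(y) − 1`, and at most two of them are
at `v`). -/
theorem deg_add_deg_add_deg_le_of_adj (D : SimpleGraph V) [DecidableRel D.Adj] {v x y : V}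
    (h : D.Adj x y) (hx : x ≠ v) (hy : y ≠ v) :
    deg D x + deg D y + deg D v ≤ D.edgeFinset.card + 3 := by
  have h1 := card_union_add_card_inter (D.incidenceFinset x) (D.incidenceFinset y)
  rw [incidenceFinset_inter_of_adj D h, card_singleton] at h1
  have h2 := card_union_add_card_inter (D.incidenceFinset x ∪ D.incidenceFinset y)
    (D.incidenceFinset v)
  have h3 : ((D.incidenceFinset x ∪ D.incidenceFinset y) ∩ D.incidenceFinset v).card ≤ 2 := by
    rw [inter_comm]
    exact (card_le_card (incidenceFinset_inter_union_subset D hx hy)).trans card_le_two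
  have h4 : (D.incidenceFinset x ∪ D.incidenceFinset y ∪ D.incidenceFinset v).card ≤
      D.edgeFinset.card :=
    card_le_card (union_subset (union_subset (D.incidenceFinset_subset x)
      (D.incidenceFinset_subset y)) (D.incidenceFinset_subset v))
  rw [deg_eq_card_incidenceFinset, deg_eq_card_incidenceFinset, deg_eq_card_incidenceFinset]
  omega

/-- A sum over the adjacent ordered pairs with first coordinate `v` is a sum over `N(v)`. -/
theorem sum_adjPairsAll_fst_eq (D : SimpleGraph V) [DecidableRel D.Adj] (v : V) (f : V × V → ℕ) :
    ∑ p ∈ (adjPairsAll D).filter (fun p => p.1 = v), f p =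
      ∑ w ∈ univ.filter (fun w => D.Adj v w), f (v, w) := by
  unfold adjPairsAll
  rw [filter_filter]
  simp only [sum_filter]
  rw [sum_product, sum_eq_single v]
  · apply sum_congr rfl
    intro w _
    simp
  · intro a _ ha
    apply sum_eq_zero
    intro w _
    simp [ha]
  · intro h
    exact absurd (mem_univ v) h

/-- A sum over the adjacent ordered pairs with second coordinate `v` is a sum over `N(v)`. -/
theorem sum_adjPairsAll_snd_eq (D : SimpleGraph V) [DecidableRel D.Adj] (v : V) (f : V × V → ℕ) :
    ∑ p ∈ (adjPairsAll D).filter (fun p => p.2 = v), f p =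
      ∑ w ∈ univ.filter (fun w => D.Adj v w), f (w, v) := by
  unfold adjPairsAll
  rw [filter_filter]
  simp only [sum_filter]
  rw [sum_product_right, sum_eq_single v]
  · apply sum_congr rfl
    intro w _
    simp [D.adj_comm w v]
  · intro a _ ha
    apply sum_eq_zero
    intro w _
    simp [ha]
  · intro h
    exact absurd (mem_univ v) h

/-- There are `d(v)` adjacent ordered pairs with first coordinate `v`. -/
theorem card_filter_fst_eq (D : SimpleGraph V) [DecidableRel D.Adj] (v : V) :
    ((adjPairsAll D).filter (fun p => p.1 = v)).card = deg D v := by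
  rw [card_eq_sum_ones, sum_adjPairsAll_fst_eq D v (fun _ => 1), ← card_eq_sum_ones]
  rfl

/-- There are `d(v)` adjacent ordered pairs with second coordinate `v`. -/
theorem card_filter_snd_eq (D : SimpleGraph V) [DecidableRel D.Adj] (v : V) :
    ((adjPairsAll D).filter (fun p => p.2 = v)).card = deg D v := by
  rw [card_eq_sum_ones, sum_adjPairsAll_snd_eq D v (fun _ => 1), ← card_eq_sum_ones]
  rfl

/-- `Σ_{(v, w), w ∈ N(v)} (d(v) + d(w)) = d(v)² + Σ_{w ∈ N(v)} d(w)`. -/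
theorem sum_filter_fst_deg_add (D : SimpleGraph V) [DecidableRel D.Adj] (v : V) :
    ∑ p ∈ (adjPairsAll D).filter (fun p => p.1 = v), (deg D p.1 + deg D p.2) =
      deg D v * deg D v + ∑ w ∈ univ.filter (fun w => D.Adj v w), deg D w := by
  rw [sum_adjPairsAll_fst_eq D v (fun p => deg D p.1 + deg D p.2)]
  simp only [sum_add_distrib, sum_const, smul_eq_mul]
  rfl

/-- `Σ_{(w, v), w ∈ N(v)} (d(w) + d(v)) = d(v)² + Σ_{w ∈ N(v)} d(w)`. -/
theorem sum_filter_snd_deg_add (D : SimpleGraph V) [DecidableRel D.Adj] (v : V) :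
    ∑ p ∈ (adjPairsAll D).filter (fun p => p.2 = v), (deg D p.1 + deg D p.2) =
      deg D v * deg D v + ∑ w ∈ univ.filter (fun w => D.Adj v w), deg D w := by
  rw [sum_adjPairsAll_snd_eq D v (fun p => deg D p.1 + deg D p.2)]
  simp only [sum_add_distrib, sum_const, smul_eq_mul]
  rw [add_comm]
  rfl

/-- **The degree budget at the neighbours of `v`:** `Σ_{w ∈ N(v)} d(w) + d(v) ≤ 2m`. -/
theorem sum_deg_neighbors_add_le (D : SimpleGraph V) [DecidableRel D.Adj] (v : V) :
    ∑ w ∈ univ.filter (fun w => D.Adj v w), deg D w + deg D v ≤ 2 * D.edgeFinset.card := by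
  have hsub : univ.filter (fun w => D.Adj v w) ⊆ univ.erase v := by
    intro w hw
    rw [mem_filter] at hw
    rw [mem_erase]
    exact ⟨(D.ne_of_adj hw.2).symm, mem_univ _⟩
  have h1 : ∑ w ∈ univ.filter (fun w => D.Adj v w), deg D w ≤ ∑ w ∈ univ.erase v, deg D w :=
    sum_le_sum_of_subset hsub
  have h2 := add_sum_erase univ (deg D) (mem_univ v)
  rw [sum_deg_eq] at h2
  omega

/-- Among the adjacent ordered pairs off `v` in the first coordinate, those with second coordinate `v` are
exactly the pairs with second coordinate `v`. -/
theorem filter_not_fst_filter_snd (D : SimpleGraph V) [DecidableRel D.Adj] (v : V) :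
    ((adjPairsAll D).filter (fun p => ¬ p.1 = v)).filter (fun p => p.2 = v) =
      (adjPairsAll D).filter (fun p => p.2 = v) := by
  rw [filter_filter]
  apply filter_congr
  intro p hp
  constructor
  · exact fun h => h.2
  · intro h2
    refine ⟨fun h1 => ?_, h2⟩
    have hadj : D.Adj p.1 p.2 := (mem_filter.mp hp).2
    exact D.ne_of_adj hadj (h1.trans h2.symm)

/-- **THE VERTEX COUNT** at a vertex `v` of degree `d`, for every finite simple graph with `m` edges:
`2 Σ_x d(x)² + 2 (m − d) d + 2 d ≤ 2 d² + 4 m + 2 (m − d)(m + 3)`, stated as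
`2 Σ_x d(x)² + R·d + 2d ≤ 2d² + 4m + R·(m + 3)` with `R = 2m − 2d` the number of adjacent ordered pairs
off `v` (the `2d` pairs touching `v` contribute `2 d² + 2 Σ_{N(v)} d(w) ≤ 2d² + 2(2m − d)`, the `R` pairs
off `v` at most `m + 3 − d` each). -/
theorem two_mul_sum_deg_sq_le (D : SimpleGraph V) [DecidableRel D.Adj] (v : V) :
    2 * ∑ x, deg D x * deg D x + (2 * D.edgeFinset.card - 2 * deg D v) * deg D v + 2 * deg D v ≤
      2 * (deg D v * deg D v) + 4 * D.edgeFinset.card +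
        (2 * D.edgeFinset.card - 2 * deg D v) * (D.edgeFinset.card + 3) := by
  -- the split of the ordered adjacent pairs: first coordinate `v` / second coordinate `v` / off `v`
  have hS := sum_adjPairsAll_deg_add D
  have hsplit1 := sum_filter_add_sum_filter_not (adjPairsAll D) (fun p => p.1 = v)
    (fun p => deg D p.1 + deg D p.2)
  have hsplit2 := sum_filter_add_sum_filter_not ((adjPairsAll D).filter (fun p => ¬ p.1 = v))
    (fun p => p.2 = v) (fun p => deg D p.1 + deg D p.2)
  rw [filter_not_fst_filter_snd] at hsplit2
  have hc1 := card_filter_add_card_filter_not (s := adjPairsAll D) (fun p => p.1 = v)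
  have hc2 := card_filter_add_card_filter_not (s := (adjPairsAll D).filter (fun p => ¬ p.1 = v))
    (fun p => p.2 = v)
  rw [filter_not_fst_filter_snd] at hc2
  rw [card_adjPairsAll, card_filter_fst_eq] at hc1
  rw [card_filter_snd_eq] at hc2
  have hfst := sum_filter_fst_deg_add D v
  have hsnd := sum_filter_snd_deg_add D v
  have hbudget := sum_deg_neighbors_add_le D v
  -- the pairs off `v`: each has `d(x) + d(y) + d(v) ≤ m + 3`
  set R := ((adjPairsAll D).filter (fun p => ¬ p.1 = v)).filter (fun p => ¬ p.2 = v) with hR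
  have hoff : ∑ p ∈ R, (deg D p.1 + deg D p.2) + R.card * deg D v ≤ R.card * (D.edgeFinset.card + 3) := by
    have h := sum_le_sum (s := R) (f := fun p => deg D p.1 + deg D p.2 + deg D v)
      (g := fun _ => D.edgeFinset.card + 3) (fun p hp => by
        rw [hR, mem_filter, mem_filter] at hp
        exact deg_add_deg_add_deg_le_of_adj D (mem_filter.mp hp.1.1).2 hp.1.2 hp.2)
    rw [sum_const, smul_eq_mul, sum_add_distrib, sum_const, smul_eq_mul] at h
    exact h
  -- pure arithmetic in the nine quantities
  set A := ∑ w ∈ univ.filter (fun w => D.Adj v w), deg D w with hA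
  set d := deg D v with hd
  set m := D.edgeFinset.card with hm
  set s2 := ∑ x, deg D x * deg D x with hs2
  set SR := ∑ p ∈ R, (deg D p.1 + deg D p.2) with hSR
  set S1 := ∑ p ∈ (adjPairsAll D).filter (fun p => p.1 = v), (deg D p.1 + deg D p.2) with hS1
  set S2 := ∑ p ∈ (adjPairsAll D).filter (fun p => p.2 = v), (deg D p.1 + deg D p.2) with hS2
  set Snot := ∑ p ∈ (adjPairsAll D).filter (fun p => ¬ p.1 = v), (deg D p.1 + deg D p.2) with hSnot
  set Rc := R.card with hRc
  set N1 := ((adjPairsAll D).filter (fun p => ¬ p.1 = v)).card with hN1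
  clear_value A d m s2 SR S1 S2 Snot Rc N1
  have hRc' : Rc = 2 * m - 2 * d := by omega
  rw [hRc'] at hoff
  obtain ⟨e, rfl⟩ : ∃ e, m = d + e := ⟨m - d, by omega⟩
  have h2e : 2 * (d + e) - 2 * d = 2 * e := by omega
  rw [h2e] at hoff ⊢
  nlinarith [hoff, hbudget, hfst, hsnd, hsplit1, hsplit2, hS]

/-- `d(v) ≤ m`: the edges at `v` are edges. -/
theorem deg_le_card_edges (D : SimpleGraph V) [DecidableRel D.Adj] (v : V) :
    deg D v ≤ D.edgeFinset.card := by
  rw [deg_eq_card_incidenceFinset]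
  exact card_le_card (D.incidenceFinset_subset v)

/-- `C(d, 2) ≤ 1` for `d ≤ 2`. -/
theorem choose_two_le_one_of_le_two (d : ℕ) (h : d ≤ 2) : d.choose 2 ≤ 1 := by
  interval_cases d <;> decide

/-- `k ≤ C(k − 1, 2) + 2` for every `k` (`(k − 2)(k − 3) ≥ 0`). -/
theorem le_choose_two_pred_add_two (k : ℕ) : k ≤ (k - 1).choose 2 + 2 := by
  rcases Nat.lt_or_ge k 4 with h | h
  · interval_cases k <;> decide
  · obtain ⟨j, rfl⟩ : ∃ j, k = j + 4 := ⟨k - 4, by omega⟩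
    have e : j + 4 - 1 = j + 3 := by omega
    rw [e]
    have h2 := two_mul_choose_two_add (j + 3)
    nlinarith [h2]

omit [DecidableEq V] in
/-- If every degree is `≤ 2`, the cherries are at most the number of vertices. -/
theorem cherries_le_card_of_deg_le_two (D : SimpleGraph V) [DecidableRel D.Adj]
    (h : ∀ v, deg D v ≤ 2) : cherries D ≤ Fintype.card V := by
  unfold cherries
  calc ∑ v, (deg D v).choose 2 ≤ ∑ _v : V, 1 :=
        sum_le_sum (fun v _ => choose_two_le_one_of_le_two _ (h v))
    _ = Fintype.card V := by rw [sum_const, smul_eq_mul, mul_one, card_univ]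

/-- **THE DIAGONAL BOUND:** every finite simple graph on `k` vertices with `m ≤ k` edges has
`Σ_v C(d(v), 2) ≤ C(k − 1, 2) + 2`.  (For `m ≤ k − 1` this is weaker than the pair count `C(m, 2)`; the content
is the row `m = k`.) -/
theorem cherries_le_choose_two_add_two (D : SimpleGraph V) [DecidableRel D.Adj]
    (hm : D.edgeFinset.card ≤ Fintype.card V) :
    cherries D ≤ (Fintype.card V - 1).choose 2 + 2 := by
  by_cases hdeg : ∀ v, deg D v ≤ 2
  · exact (cherries_le_card_of_deg_le_two D hdeg).trans (le_choose_two_pred_add_two _)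
  · push Not at hdeg
    obtain ⟨v, hv⟩ := hdeg
    have hcount := two_mul_sum_deg_sq_le D v
    have hdm := deg_le_card_edges D v
    have hc := two_mul_cherries_add D
    rw [sum_deg_eq] at hc
    have hdk : deg D v + 1 ≤ Fintype.card V := by
      have hsub : univ.filter (fun w => D.Adj v w) ⊆ univ.erase v := by
        intro w hw
        rw [mem_filter] at hw
        rw [mem_erase]
        exact ⟨(D.ne_of_adj hw.2).symm, mem_univ _⟩
      have h1 : deg D v ≤ (univ.erase v).card := card_le_card hsub
      rw [card_erase_of_mem (mem_univ v), card_univ] at h1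
      have h2 : 1 ≤ Fintype.card V := Fintype.card_pos_iff.mpr ⟨v⟩
      omega
    set d := deg D v with hd
    set m := D.edgeFinset.card with hm'
    set k := Fintype.card V with hk
    set c := cherries D with hcD
    set s2 := ∑ x, deg D x * deg D x with hs2
    clear_value d m k c s2
    obtain ⟨a, rfl⟩ : ∃ a, d = a + 3 := ⟨d - 3, by omega⟩
    obtain ⟨e, rfl⟩ : ∃ e, m = a + 3 + e := ⟨m - (a + 3), by omega⟩
    obtain ⟨g, rfl⟩ : ∃ g, k = a + 3 + e + g := ⟨k - (a + 3 + e), by omega⟩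
    have h2e : 2 * (a + 3 + e) - 2 * (a + 3) = 2 * e := by omega
    rw [h2e] at hcount
    have hk1 : a + 3 + e + g - 1 = a + 2 + e + g := by omega
    rw [hk1]
    have hC := two_mul_choose_two_add (a + 2 + e + g)
    have heg : 1 ≤ e + g := by omega
    have hmul : a * 1 ≤ a * (e + g) := Nat.mul_le_mul_left a heg
    nlinarith [hcount, hc, hC, hmul, Nat.zero_le (g * g), Nat.zero_le (e * g), Nat.zero_le g]

/-- The diagonal bound on `Fin k`: every graph with `k` edges on `k` vertices. -/
theorem cherries_le_of_card_edges_eq (k : ℕ) (D : SimpleGraph (Fin k)) [DecidableRel D.Adj]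
    (hm : D.edgeFinset.card = k) : cherries D ≤ (k - 1).choose 2 + 2 := by
  have h := cherries_le_choose_two_add_two D (by rw [hm, Fintype.card_fin])
  rwa [Fintype.card_fin] at h

end C047

end TriangleCap

end PercRepro
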